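import Literature.IUT.HodgeTheaters.PMBaseStrips

/-!
# [IUTchI] §6, Examples 6.2 and 6.3: the model base-`Θ^±`- and base-`Θ^{ell}`-bridges

Mochizuki, *Inter-universal Teichmüller theory I*, §6, Example 6.2 (i)–(iii) pp. 159–160 and
Example 6.3 (i)–(ii) pp. 160–161, kurims manuscript (May 2020)
([IUTchI] Ex 6.2-6.3 pp.159-161) [claim: Mochizuki2012, status: disputed], over the base interface `PMBaseKit`:

* label bookkeeping on an `𝔽_l^±`-group `T` used from Def 6.4 on: the negation `t ↦ −t`, the zero
  element, the quotient `|T| := T/{±1}` and `T^⋇ := |T| \ {0}` ([IUTchI] Def 6.4 (i) p. 162), and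
  "the `𝔽_l^±`-torsor structure determined by the `𝔽_l^±`-group structure on `T`" (Def 6.4 (iii)
  p. 163) — `FlPMGroup.neg`, `.zero`, `.Abs`, `.AbsStar`, `.toTorsor`;
* capsules of `𝒟`-prime-strips and composition of poly-morphisms ([IUTchI] §0 pp. 33–34;
  TODO-merge:abc-iut-L5-t1);
* Example 6.2 (i): the model data `(𝔇_±, 𝔇_≻, φ^{Θ±}_±)` — copies `𝔇_t`, `t ∈ 𝔽_l`, and `𝔇_≻` of the
  tautological `𝒟`-prime-strip and the positive `+`-full poly-isomorphisms `φ^{Θ±}_t : 𝔇_t ⥲ 𝔇_≻`;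
  (ii) the poly-automorphism `−1_{𝔽_l}`; (iii) the poly-automorphisms `α^{Θ±}`, `α ∈ {±1}^𝕍`; the
  printed "one verifies immediately that … is compatible with `φ^{Θ±}_±`" PROVED
  (`Ex62.negOne_compatible`, `Ex62.signed_compatible`);
* Example 6.3 (i): the model `𝒟-Θ^{ell}`-bridge `φ^{Θell}_± = {φ^{Θell}_t : 𝔇_t → 𝒟^{⊚±}}_{t ∈ 𝔽_l}`,
  `φ^{Θell}_{v_0} = {β ∘ φ^{Θell}_{•,v} ∘ α | α ∈ Aut_+(𝒟_{v_0}), β ∈ Aut_csp(𝒟^{⊚±})}`, `φ^{Θell}_t` its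
  post-composite with the poly-action of `t ∈ 𝔽_l ⊆ 𝔽_l^{⋊±}` on `𝒟^{⊚±}`; (ii) the poly-action of
  `𝔽_l^{⋊±}` on `(𝔇_±, 𝒟^{⊚±}, φ^{Θell}_±)` and its printed equivariance as a named statement.
-/

namespace Literature.IUT.HodgeTheaters

open CategoryTheory

universe u

/-! ### Label bookkeeping on an `𝔽_l^±`-group -/

namespace FlPMGroup

variable {l : ℕ} {E : Type*} (S : FlPMGroup l E)

/-- The negation `t ↦ −t` of an `𝔽_l^±`-group (for its natural `𝔽_l`-module structure, [IUTchI]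
Def 6.1 (i) p. 155), read in any chart. ([IUTchI] Def 6.1 (i) p.155) [claim: Mochizuki2012, status: disputed] -/
noncomputable def neg : Equiv.Perm E := S.chart₀.trans ((Equiv.neg (ZMod l)).trans S.chart₀.symm)

/-- Every chart carries `neg` to `z ↦ −z`. ([IUTchI] Def 6.1 (i) p.155) [claim: Mochizuki2012, status: disputed] -/
theorem chart_neg {e : E ≃ ZMod l} (he : e ∈ S.charts) (t : E) : e (S.neg t) = -e t := by
  obtain ⟨ε, rfl⟩ := S.exists_sign_of_mem S.chart₀_mem he
  simp [neg, smul_neg]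

/-- `neg` is an involution. ([IUTchI] Def 6.1 (i) p.155) [claim: Mochizuki2012, status: disputed] -/
theorem neg_neg (t : E) : S.neg (S.neg t) = t := by
  apply S.chart₀.injective
  rw [S.chart_neg S.chart₀_mem, S.chart_neg S.chart₀_mem, _root_.neg_neg]

/-- The zero element of an `𝔽_l^±`-group (its natural `𝔽_l`-module structure), read in any chart.
([IUTchI] Def 6.1 (i) p.155) [claim: Mochizuki2012, status: disputed] -/
noncomputable def zero : E := S.chart₀.symm 0

/-- Every chart carries `zero` to `0`. ([IUTchI] Def 6.1 (i) p.155) [claim: Mochizuki2012, status: disputed] -/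
theorem chart_zero {e : E ≃ ZMod l} (he : e ∈ S.charts) : e S.zero = 0 := by
  obtain ⟨ε, rfl⟩ := S.exists_sign_of_mem S.chart₀_mem he
  simp [zero]

/-- `−0 = 0`. ([IUTchI] Def 6.1 (i) p.155) [claim: Mochizuki2012, status: disputed] -/
theorem neg_zero : S.neg S.zero = S.zero := by
  apply S.chart₀.injective
  rw [S.chart_neg S.chart₀_mem, S.chart_zero S.chart₀_mem, _root_.neg_zero]

/-- The equivalence relation `t ~ ±t` on an `𝔽_l^±`-group `T`, whose quotient is `|T|` ([IUTchI] Def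
6.4 (i) p. 162 "the quotient `|T|` of the index set `T` … by the action of `{±1}`").
([IUTchI] Def 6.4 (i) p.162) [claim: Mochizuki2012, status: disputed] -/
def absSetoid : Setoid E where
  r a b := b = a ∨ b = S.neg a
  iseqv := by
    refine ⟨fun a => Or.inl rfl, ?_, ?_⟩
    · rintro a b (rfl | rfl)
      · exact Or.inl rfl
      · exact Or.inr (S.neg_neg a).symm
    · rintro a b c (rfl | rfl) (rfl | rfl)
      · exact Or.inl rfl
      · exact Or.inr rfl
      · exact Or.inr rfl
      · exact Or.inl (S.neg_neg a)

/-- `|T| := T/{±1}` for an `𝔽_l^±`-group `T` ([IUTchI] Def 6.4 (i) p. 162); for `T = 𝔽_l` this is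
`|𝔽_l|` of cardinality `l^± = (l+1)/2`. ([IUTchI] Def 6.4 (i) p.162) [claim: Mochizuki2012, status: disputed] -/
def Abs : Type _ := Quotient S.absSetoid

/-- The class `|t| ∈ |T|` of `t ∈ T`. ([IUTchI] Def 6.4 (i) p.162) [claim: Mochizuki2012, status: disputed] -/
def toAbs (t : E) : S.Abs := Quotient.mk S.absSetoid t

/-- `T^⋇ := |T| \ {0}`, "the subset of nonzero elements of `|T|`" ([IUTchI] Def 6.4 (i) p. 162).
([IUTchI] Def 6.4 (i) p.162) [claim: Mochizuki2012, status: disputed] -/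
def AbsStar : Type _ := {q : S.Abs // q ≠ S.toAbs S.zero}

/-- "the `𝔽_l^±`-torsor structure determined by the `𝔽_l^±`-group structure on `T`" ([IUTchI] Def 6.4
(iii) p. 163): enlarge the `{±1}`-orbit of charts to its `𝔽_l^{⋊±}`-orbit.
([IUTchI] Def 6.4 (iii) p.163) [claim: Mochizuki2012, status: disputed] -/
def toTorsor : FlPMTorsor l E where
  charts := {f | ∃ e ∈ S.charts, ∃ g : FlPM l, f = e.trans (FlPM.toPerm l g)}
  nonempty := ⟨_, S.chart₀, S.chart₀_mem, 1, rfl⟩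
  eq_orbit := by
    rintro f ⟨e, he, g, rfl⟩
    ext f'
    constructor
    · rintro ⟨e', he', g', rfl⟩
      obtain ⟨ε, rfl⟩ := S.exists_sign_of_mem he he'
      refine ⟨g' * FlPM.mk 0 ε * g⁻¹, ?_⟩
      ext t
      simp only [Equiv.trans_apply, FlPM.toPerm_apply, signPerm_apply, mul_smul, inv_smul_smul,
        FlPM.mk_smul, add_zero]
    · rintro ⟨h, rfl⟩
      refine ⟨e, he, h * g, ?_⟩
      ext t
      simp only [Equiv.trans_apply, FlPM.toPerm_apply, mul_smul]

/-- The charts of the group structure are charts of the induced torsor structure.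
([IUTchI] Def 6.4 (iii) p.163) [claim: Mochizuki2012, status: disputed] -/
theorem mem_toTorsor_charts {e : E ≃ ZMod l} (he : e ∈ S.charts) : e ∈ S.toTorsor.charts :=
  ⟨e, he, 1, by ext; simp⟩

end FlPMGroup

namespace PMBaseKit

variable {l : ℕ} (K : PMBaseKit.{u} l)

/-! ### Capsules of `𝒟`-prime-strips and composition of poly-morphisms (§0; TODO-merge:abc-iut-L5-t1) -/

/-- A capsule of `𝒟`-prime-strips with (finite) index set `T`: "a finite collection `{A_j}_{j∈J}` of
objects" ([IUTchI] §0 p. 33; TODO-merge:abc-iut-L5-t1). ([IUTchI] §0 p.33) [claim: Mochizuki2012, status: disputed] -/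
abbrev DCapsule (T : Type) : Type u := T → K.DStrip

namespace DStrip

variable {K}

/-- Composition of isomorphisms of `𝒟`-prime-strips (componentwise).
([IUTchI] Def 4.1 (iv) p.96) [claim: Mochizuki2012, status: disputed] -/
def Iso.trans {D₁ D₂ D₃ : K.DStrip} (f : D₁.Iso D₂) (g : D₂.Iso D₃) : D₁.Iso D₃ := fun v => f v ≪≫ g v

/-- The inverse of an isomorphism of `𝒟`-prime-strips. ([IUTchI] Def 4.1 (iv) p.96) [claim: Mochizuki2012, status: disputed] -/
def Iso.symm {D₁ D₂ : K.DStrip} (f : D₁.Iso D₂) : D₂.Iso D₁ := fun v => (f v).symm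

/-- The identity isomorphism of a `𝒟`-prime-strip. ([IUTchI] Def 4.1 (iv) p.96) [claim: Mochizuki2012, status: disputed] -/
def Iso.refl (D : K.DStrip) : D.Iso D := fun v => CategoryTheory.Iso.refl (D.obj v)

/-- "The composite of a poly-morphism `{f_i : A → B}` with a poly-morphism `{g_j : B → C}` is defined
to be the poly-morphism given by the set `{g_j ∘ f_i : A → C}`" ([IUTchI] §0 p. 33), for
poly-isomorphisms of `𝒟`-prime-strips (TODO-merge:abc-iut-L5-t1). ([IUTchI] §0 p.33) [claim: Mochizuki2012, status: disputed] -/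
def polyComp {D₁ D₂ D₃ : K.DStrip} (P : Set (D₁.Iso D₂)) (Q : Set (D₂.Iso D₃)) : Set (D₁.Iso D₃) :=
  {h | ∃ f ∈ P, ∃ g ∈ Q, h = f.trans g}

/-- Conjugating a poly-isomorphism `P : 𝔇₁ ⥲ 𝔇₂` by isomorphisms `α : 𝔇₁ ⥲ 𝔇₁'`, `β : 𝔇₂ ⥲ 𝔇₂'`:
`{β ∘ f ∘ α⁻¹}` — the operation "conjugation by which maps `φ ↦ †φ`" of [IUTchI] Def 6.4 (i)–(iii)
pp. 162–163. ([IUTchI] Def 6.4 (i) p.162) [claim: Mochizuki2012, status: disputed] -/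
def polyConj {D₁ D₂ D₁' D₂' : K.DStrip} (α : D₁.Iso D₁') (β : D₂.Iso D₂') (P : Set (D₁.Iso D₂)) :
    Set (D₁'.Iso D₂') :=
  {h | ∃ f ∈ P, h = (α.symm.trans f).trans β}

end DStrip

/-! ### Example 6.2: model base-`Θ^±`-bridges -/

namespace Ex62

/-- `𝔇_≻ = {𝒟_{≻,v}}_{v∈𝕍}`, a copy of the tautological `𝒟`-prime-strip ([IUTchI] Ex 6.2 (i) p. 159).
([IUTchI] Ex 6.2 (i) p.159) [claim: Mochizuki2012, status: disputed] -/
abbrev codomain : K.DStrip := DStrip.model K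

/-- `𝔇_± = {𝔇_t}_{t ∈ 𝔽_l}`, `𝔇_t = {𝒟_{v_t}}_{v∈𝕍}` copies of the tautological `𝒟`-prime-strip indexed
by `t ∈ 𝔽_l`, `𝔽_l` regarded as an `𝔽_l^±`-group via `FlPMGroup.tautological` ([IUTchI] Ex 6.2 (i)
pp. 159–160). ([IUTchI] Ex 6.2 (i) p.160) [claim: Mochizuki2012, status: disputed] -/
abbrev capsule : K.DCapsule (ZMod l) := fun _ => DStrip.model K

/-- `φ^{Θ±}_t : 𝔇_t ⥲ 𝔇_≻`, "the respective positive `+`-full poly-isomorphisms, i.e., relative to the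
respective identifications with the tautological `𝒟`-prime-strip" ([IUTchI] Ex 6.2 (i) p. 160): the
set `Aut_+` of the tautological strip; `φ^{Θ±}_± := {φ^{Θ±}_t}_{t ∈ 𝔽_l}`.
([IUTchI] Ex 6.2 (i) p.160) [claim: Mochizuki2012, status: disputed] -/
def poly (_t : ZMod l) : Set ((DStrip.model K).Iso (DStrip.model K)) :=
  (DStrip.model K).signedPolyAut fun _ => 1

/-- A poly-automorphism of the model data `(𝔇_±, 𝔇_≻, φ^{Θ±}_±)` "acting on `𝔽_l`" by a permutation
`σ` and inducing poly-isomorphisms `𝔇_t ⥲ 𝔇_{σ t}` and `𝔇_≻ ⥲ 𝔇_≻` — the shape of the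
poly-automorphisms `−1_{𝔽_l}`, `α^{Θ±}` of [IUTchI] Ex 6.2 (ii), (iii) p. 160.
([IUTchI] Ex 6.2 (ii) p.160) [claim: Mochizuki2012, status: disputed] -/
structure PolyAut where
  /-- the action on the index set `𝔽_l` -/
  perm : Equiv.Perm (ZMod l)
  /-- the poly-isomorphisms `𝔇_t ⥲ 𝔇_{σ t}` (all copies of the tautological strip) -/
  onCapsule : ZMod l → Set ((DStrip.model K).Iso (DStrip.model K))
  /-- the poly-isomorphism `𝔇_≻ ⥲ 𝔇_≻` -/
  onCodomain : Set ((DStrip.model K).Iso (DStrip.model K))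

/-- "compatible [in the evident sense] with `φ^{Θ±}_±`" ([IUTchI] Ex 6.2 (ii), (iii) p. 160): for each
`t`, the composite poly-morphisms `𝔇_t ⥲ 𝔇_{σ t} ⥲ 𝔇_≻` (via `φ^{Θ±}_{σ t}`) and `𝔇_t ⥲ 𝔇_≻ ⥲ 𝔇_≻`
(via `φ^{Θ±}_t`) coincide. ([IUTchI] Ex 6.2 (ii) p.160) [claim: Mochizuki2012, status: disputed] -/
def PolyAut.Compatible (A : PolyAut K) : Prop :=
  ∀ t, DStrip.polyComp (A.onCapsule t) (poly K (A.perm t)) = DStrip.polyComp (poly K t) A.onCodomain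

/-- `−1_{𝔽_l}`: "acts on `𝔽_l` as multiplication by `−1` and induces the poly-isomorphisms `𝔇_t ⥲ 𝔇_{−t}`
and `𝔇_≻ ⥲ 𝔇_≻` determined by the `+`-full poly-automorphism whose sign at every `v ∈ 𝕍` is negative",
a poly-automorphism of order two ([IUTchI] Ex 6.2 (ii) p. 160). ([IUTchI] Ex 6.2 (ii) p.160) [claim: Mochizuki2012, status: disputed] -/
def negOne : PolyAut K where
  perm := Equiv.neg (ZMod l)
  onCapsule _ := (DStrip.model K).signedPolyAut fun _ => -1
  onCodomain := (DStrip.model K).signedPolyAut fun _ => -1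

/-- `α^{Θ±}` for `α ∈ {±1}^𝕍`: "acts on `𝔽_l` as the identity and on `𝔇_t`, for `t ∈ 𝔽_l`, and `𝔇_≻` as
the `α`-signed `+`-full poly-automorphism", a poly-automorphism of order `∈ {1, 2}` ([IUTchI] Ex 6.2
(iii) p. 160). ([IUTchI] Ex 6.2 (iii) p.160) [claim: Mochizuki2012, status: disputed] -/
def signed (α : K.V → ℤˣ) : PolyAut K where
  perm := Equiv.refl _
  onCapsule _ := (DStrip.model K).signedPolyAut α
  onCodomain := (DStrip.model K).signedPolyAut α

/-- "One verifies immediately that `−1_{𝔽_l}`, defined in this way, is compatible [in the evident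
sense] with `φ^{Θ±}_±`" ([IUTchI] Ex 6.2 (ii) p. 160) — named statement.
([IUTchI] Ex 6.2 (ii) p.160) [claim: Mochizuki2012, status: disputed] -/
def NegOneCompatible : Prop := (negOne K).Compatible

/-- "One verifies immediately that `α^{Θ±}`, defined in this way, is compatible [in the evident sense]
with `φ^{Θ±}_±`" ([IUTchI] Ex 6.2 (iii) p. 160) — named statement.
([IUTchI] Ex 6.2 (iii) p.160) [claim: Mochizuki2012, status: disputed] -/
def SignedCompatible (α : K.V → ℤˣ) : Prop := (signed K α).Compatible

end Ex62

/-! #### The compatibilities of Example 6.2 (ii), (iii) — PROVED -/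

section Compat

variable {K}

/-- Membership in an `α`-signed `+`-full poly-automorphism `Aut^α(†𝔇)` is preserved by composing with a
positive automorphism on either side (`Aut_+(†𝒟_v)` is a subgroup and `Aut_−(†𝒟_v)` its complement).
([IUTchI] Ex 6.2 (iii) p.160) [claim: Mochizuki2012, status: disputed] -/
theorem DStrip.trans_mem_signedPolyAut {D : K.DStrip} {α : K.V → ℤˣ} {f g : D.Iso D}
    (hf : f ∈ D.signedPolyAut α) (hg : g ∈ D.signedPolyAut fun _ => 1) :
    f.trans g ∈ D.signedPolyAut α ∧ g.trans f ∈ D.signedPolyAut α := by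
  constructor <;> intro v <;> obtain ⟨hf1, hf2⟩ := hf v <;> obtain ⟨hg1, -⟩ := hg v <;>
    have hgp : (g v : Aut (D.obj v)) ∈ K.autPlus v (D.obj v) := hg1 rfl
  · refine ⟨fun h1 => ?_, fun h2 => ?_⟩
    · exact (K.autPlus v (D.obj v)).mul_mem hgp (hf1 h1)
    · intro hmem
      apply hf2 h2
      have := (K.autPlus v (D.obj v)).mul_mem ((K.autPlus v (D.obj v)).inv_mem hgp) hmem
      simpa [DStrip.Iso.trans, Aut.Aut_mul_def, Aut.Aut_inv_def] using this
  · refine ⟨fun h1 => ?_, fun h2 => ?_⟩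
    · exact (K.autPlus v (D.obj v)).mul_mem (hf1 h1) hgp
    · intro hmem
      apply hf2 h2
      have := (K.autPlus v (D.obj v)).mul_mem hmem ((K.autPlus v (D.obj v)).inv_mem hgp)
      simpa [DStrip.Iso.trans, Aut.Aut_mul_def, Aut.Aut_inv_def] using this

/-- The identity of a `𝒟`-prime-strip is a positive automorphism.
([IUTchI] Def 6.1 (iii) p.157) [claim: Mochizuki2012, status: disputed] -/
theorem DStrip.refl_mem_signedPolyAut_one (D : K.DStrip) : DStrip.Iso.refl D ∈ D.signedPolyAut fun _ => 1 :=
  fun v => ⟨fun _ => (K.autPlus v (D.obj v)).one_mem, fun h => absurd (show (1 : ℤˣ) = -1 from h) (by decide)⟩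

/-- `Aut^α(†𝔇) · Aut_+(†𝔇) = Aut^α(†𝔇) = Aut_+(†𝔇) · Aut^α(†𝔇)` as composite poly-morphisms.
([IUTchI] Ex 6.2 (iii) p.160) [claim: Mochizuki2012, status: disputed] -/
theorem DStrip.polyComp_signed_one (D : K.DStrip) (α : K.V → ℤˣ) :
    DStrip.polyComp (D.signedPolyAut α) (D.signedPolyAut fun _ => 1) = D.signedPolyAut α ∧
      DStrip.polyComp (D.signedPolyAut fun _ => 1) (D.signedPolyAut α) = D.signedPolyAut α := by
  constructor <;> ext h <;> constructor
  · rintro ⟨f, hf, g, hg, rfl⟩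
    exact (DStrip.trans_mem_signedPolyAut hf hg).1
  · intro hh
    exact ⟨h, hh, _, D.refl_mem_signedPolyAut_one, funext fun v => (Iso.trans_refl _).symm⟩
  · rintro ⟨g, hg, f, hf, rfl⟩
    exact (DStrip.trans_mem_signedPolyAut hf hg).2
  · intro hh
    exact ⟨_, D.refl_mem_signedPolyAut_one, h, hh, funext fun v => (Iso.refl_trans _).symm⟩

/-- **Ex 6.2 (ii)**: "One verifies immediately that `−1_{𝔽_l}`, defined in this way, is compatible [in the
evident sense] with `φ^{Θ±}_±`" ([IUTchI] Ex 6.2 (ii) p. 160) — PROVED.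
([IUTchI] Ex 6.2 (ii) p.160) [claim: Mochizuki2012, status: disputed] -/
theorem Ex62.negOne_compatible : Ex62.NegOneCompatible K := fun _ => by
  show DStrip.polyComp ((DStrip.model K).signedPolyAut fun _ => -1)
      ((DStrip.model K).signedPolyAut fun _ => 1) =
    DStrip.polyComp ((DStrip.model K).signedPolyAut fun _ => 1) ((DStrip.model K).signedPolyAut fun _ => -1)
  rw [(DStrip.polyComp_signed_one (DStrip.model K) fun _ => -1).1,
    (DStrip.polyComp_signed_one (DStrip.model K) fun _ => -1).2]

/-- `Ex62.NegOneCompatible` holds for all parameters — `_holds` alias of `Ex62.negOne_compatible`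
above (appended 2026-08-28, D-0026 bookkeeping: the proof term is the existing theorem of this
file; no statement, definition or attribute is edited; no new named fact). ([IUTchI] Ex 6.2 (ii) p.160)
[claim: Mochizuki2012, status: disputed] -/
theorem Ex62.NegOneCompatible_holds : Ex62.NegOneCompatible K :=
  Ex62.negOne_compatible (K := K)

/-- **Ex 6.2 (iii)**: "One verifies immediately that `α^{Θ±}`, defined in this way, is compatible [in the
evident sense] with `φ^{Θ±}_±`" ([IUTchI] Ex 6.2 (iii) p. 160) — PROVED.
([IUTchI] Ex 6.2 (iii) p.160) [claim: Mochizuki2012, status: disputed] -/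
theorem Ex62.signed_compatible (α : K.V → ℤˣ) : Ex62.SignedCompatible K α := fun _ => by
  show DStrip.polyComp ((DStrip.model K).signedPolyAut α) ((DStrip.model K).signedPolyAut fun _ => 1) =
    DStrip.polyComp ((DStrip.model K).signedPolyAut fun _ => 1) ((DStrip.model K).signedPolyAut α)
  rw [(DStrip.polyComp_signed_one (DStrip.model K) α).1, (DStrip.polyComp_signed_one (DStrip.model K) α).2]

end Compat


/-! ### Example 6.3: model base-`Θ^{ell}`-bridges -/

namespace Ex63

/-- **The synchronisation law of Example 6.3 (i)** ([IUTchI] Ex 6.3 (i) pp. 160–161): the morphism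
`φ^{Θell}_{•,v}` ("the natural composite `X→_v → X_v → X_K`") induces on ±-label classes of cusps the
SAME identification with `𝔽_l` at every `v` — the fixed chart `LabCusp^±(𝒟^{⊚±}) ⥲ 𝔽_l` (p. 160) pulls
back, up to `{±1}`, to the natural chart of `LabCusp^±(𝒟_v)` ("a natural bijection … `LabCusp^±(†𝒟_v) ⥲ 𝔽_l^±`
… well-defined up to multiplication by `±1`", Def 6.1 (iii) p. 157). This law is what makes Prop 6.5 (i),
second sentence (`DThetaEllBridge.XiGroupCompat`: "follows immediately from the definitions", p. 164)
derivable; `PMBaseKit` (frozen) only records that the pulled-back chart lies in the `𝔽_l^{⋊±}`-orbit,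
separately at each `v` (audit abc-iut-L5-t6 R7-L5t4-F1), so the law is stated here as a named condition on
the kit. ([IUTchI] Ex 6.3 (i) p.161) [claim: Mochizuki2012, status: disputed] -/
def PhiEllSync : Prop :=
  ∀ v, ∀ e ∈ (K.labPM v (K.model v) ⟨Iso.refl _⟩).charts, ∃ ε : ℤˣ,
    (Equiv.ofBijective _ (K.labOfHom_phiEll_bijective v)).symm.trans e = K.gChart₀.trans (signPerm l ε)

/-- The poly-action of `γ ∈ 𝔽_l^{⋊±}` on `𝒟^{⊚±}` ([IUTchI] Ex 6.3 (i) p. 161: "the isomorphism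
`Aut_±(𝒟^{⊚±})/Aut_csp(𝒟^{⊚±}) ⥲ 𝔽_l^{⋊±}` … which we shall use to identify" them, via the fixed chart
`LabCusp^±(𝒟^{⊚±}) ⥲ 𝔽_l`): the `Aut_csp`-coset of elements of `Aut_±(𝒟^{⊚±})` acting on `±`-label
classes as `γ` acts on `𝔽_l`. ([IUTchI] Ex 6.3 (i) p.161) [claim: Mochizuki2012, status: disputed] -/
def lifts (γ : FlPM l) : Set (Aut K.gModel) :=
  {b | b ∈ K.autPMg K.gModel ∧ K.gLabMap b = K.gChart₀.trans ((FlPM.toPerm l γ).trans K.gChart₀.symm)}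

/-- `φ^{Θell}_{v_t} : 𝒟_{v_t} → 𝒟^{⊚±}` for `t ∈ 𝔽_l`: for `t = 0` "the poly-morphism given by the collection
of morphisms `β ∘ φ^{Θell}_{•,v} ∘ α`, where `α ∈ Aut_+(𝒟_{v_0})`, `β ∈ Aut_csp(𝒟^{⊚±})`"; for general `t`
"the result of post-composing `φ^{Θell}_0` with the poly-action of `t` on `𝒟^{⊚±}` [and pre-composing
with the tautological identification of `𝒟_0` with `𝒟_t`]" ([IUTchI] Ex 6.3 (i) p. 161); `𝒟_{v_t}` is
the model `𝒟_v`. ([IUTchI] Ex 6.3 (i) p.161) [claim: Mochizuki2012, status: disputed] -/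
def poly (t : ZMod l) (v : K.V) : Set (K.model v ⟶ (K.atV v).obj K.gModel) :=
  {f | ∃ a : Aut (K.model v), a ∈ K.autPlus v (K.model v) ∧ ∃ b ∈ lifts K (FlPM.transl t),
    f = a.hom ≫ K.phiEll v ≫ (K.atV v).map b.hom}

/-- For `t = 0` the lifts are exactly `Aut_csp(𝒟^{⊚±})`, so `poly 0` is `φ^{Θell}_0` as printed.
([IUTchI] Ex 6.3 (i) p.161) [claim: Mochizuki2012, status: disputed] -/
theorem lifts_transl_zero : lifts K (FlPM.transl 0) = K.autCsp K.gModel := by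
  ext b
  simp only [lifts, Set.mem_setOf_eq, SetLike.mem_coe]
  have h1 : K.gChart₀.trans ((FlPM.toPerm l (FlPM.transl 0)).trans K.gChart₀.symm) = Equiv.refl _ := by
    ext x; simp
  rw [h1]
  constructor
  · rintro ⟨-, hb⟩
    exact MonoidHom.mem_ker.mpr hb
  · intro hb
    exact ⟨K.autCsp_le_autPMg _ hb, MonoidHom.mem_ker.mp hb⟩

/-- A poly-automorphism of the model data `(𝔇_±, 𝒟^{⊚±}, φ^{Θell}_±)`: a permutation of `𝔽_l`,
poly-isomorphisms `𝔇_t ⥲ 𝔇_{σ t}`, and a poly-automorphism of `𝒟^{⊚±}` — the shape of the `γ_±` of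
[IUTchI] Ex 6.3 (ii) p. 161. ([IUTchI] Ex 6.3 (ii) p.161) [claim: Mochizuki2012, status: disputed] -/
structure PolyAut where
  /-- the action on the index set `𝔽_l` -/
  perm : Equiv.Perm (ZMod l)
  /-- the poly-isomorphisms `𝔇_t ⥲ 𝔇_{σ t}` -/
  onCapsule : ZMod l → Set ((DStrip.model K).Iso (DStrip.model K))
  /-- the poly-automorphism of `𝒟^{⊚±}` -/
  onGlob : Set (Aut K.gModel)

/-- `γ_±` for `γ ∈ 𝔽_l^{⋊±}`: "acts on `𝔽_l` via the usual action of `𝔽_l^{⋊±}` on `𝔽_l` and, for `t ∈ 𝔽_l`,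
induces the `+`-full poly-isomorphism `𝔇_t ⥲ 𝔇_{γ(t)}` whose sign at every `v ∈ 𝕍` is equal to the sign
of `γ`", together with the poly-action of `γ` on `𝒟^{⊚±}` ([IUTchI] Ex 6.3 (ii) p. 161).
([IUTchI] Ex 6.3 (ii) p.161) [claim: Mochizuki2012, status: disputed] -/
def polyAction (γ : FlPM l) : PolyAut K where
  perm := FlPM.toPerm l γ
  onCapsule _ := (DStrip.model K).signedPolyAut fun _ => γ.right
  onGlob := lifts K γ

/-- "`φ^{Θell}_±` is equivariant with respect to these poly-actions of `𝔽_l^{⋊±}` on `𝔇_±` and `𝒟^{⊚±}`"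
([IUTchI] Ex 6.3 (ii) p. 161): for every `t` and `v`, post-composing `φ^{Θell}_{v_t}` with the
poly-action of `γ` on `𝒟^{⊚±}` gives the same poly-morphism as pre-composing `φ^{Θell}_{v_{γ t}}` with the
poly-isomorphism `𝒟_{v_t} ⥲ 𝒟_{v_{γ t}}` — named statement. ([IUTchI] Ex 6.3 (ii) p.161) [claim: Mochizuki2012, status: disputed] -/
def Equivariant (γ : FlPM l) : Prop :=
  ∀ (t : ZMod l) (v : K.V),
    {h | ∃ f ∈ poly K t v, ∃ b ∈ (polyAction K γ).onGlob, h = f ≫ (K.atV v).map b.hom} =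
      {h | ∃ p ∈ (polyAction K γ).onCapsule t, ∃ g ∈ poly K (γ • t) v, h = (p v).hom ≫ g}

end Ex63

end PMBaseKit

end Literature.IUT.HodgeTheaters
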